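import Summits.QuantumFields.YangMills.Theorems.LuscherReductionTwistedTraceScalingBOCentralTube
import Summits.QuantumFields.YangMills.Theorems.LuscherReductionTwistedTraceScalingFPWeightOrbitRep
import Mathlib.LinearAlgebra.CrossProduct
import HarnessLib

/-!
# (C1c'-β) THE RELATIVE COORDINATE OF A CHART POINT: `relLinkVec (P w) = chartVec w − (constant mode) − O(ρ²)`, hence `|q(relLinkVec (P w)) − q(chartVec w)| ≤ 72|E|(96t+b)ρ³` on the chart ball
# (lane A of S-BASE, crux `TwistedTraceScaling` stmt-QuantumFields-20203, C4-CORE, the (OD) pen, step (4) of the (C1c') plan of `pub/ym-fleet/ym-luscher-20007-p1/HANDOFF-g17.md`)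

The (C1c') hypotheses of `…BOCentralTube.central_transfer_two_sided_of_localisedAvg(_local)` are stated with the stiff exponent at the CHART coordinate, `q(chartVec w)`, while the BO function
carries `Ω_G(relLinkVec V)`, i.e. `q(relLinkVec (P w))`.  This file controls the difference on the chart ball `Σ_a w_e a² ≤ ρ²` (`0 ≤ ρ ≤ 1/5`):
* §1 bounds on the polar-mean chart of `P(w)`: relative coordinates `v_e = vecPart(P(w)_e · p_k⁻¹)` and slow vector parts `κ_k = vecPart p_k` (`…FPWeightOrbitRep.polarMean_near` with
  `τ = ρ²/2`: `|κ_{k,a}| ≤ 2ρ`, `0 ≤ 1 − scalarPart p_k ≤ 12ρ²`); a component bound for the cross product;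
* §2 ★ `relLinkVec_chart_decomposition` — `chartVec w − relLinkVec (P w) = linkEmbed κ̄ + Rem` with the CONSTANT MODE `κ̄(e) = κ_{dir e}` (`…StiffHessian.latCurl_constMode`: in `ker H`, hence
  invisible to `q` by `…BOCentralChart.stiffGaussExp_add_of_ker`) and `|Rem_{e,a}| ≤ 7ρ²` (`vecPart_mul_inv`: `v = −s_w κ + s_p s_w w − s_w(w × κ)`);
* §3 ★★ `abs_stiffGaussExp_relLinkVec_sub_chart_le` — `|q_{t,b}(relLinkVec (P w)) − q_{t,b}(chartVec w)| ≤ 72·|E|·(96t + b)·ρ³` (`…BOCentralChart.abs_stiffGaussExp_sub_le`).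
With `ρ = β^{-1/2}ℓ²` and `(t,b) = (β/2, β)` this is `O(|E|β^{-1/2}ℓ⁶)`, the same order as the magnetic cubic error of the chart sandwich.
HONEST FRAMING: chart geometry for a stub of a child of the CONDITIONAL route R2b1; (C1c') steps (2),(3),(5), (C4), (C5), (B-ST) OPEN; C4-CORE OPEN; not infinite volume, not a gap, not Clay.
-/

set_option autoImplicit false

noncomputable section

open MeasureTheory Filter Topology Real
open scoped BigOperators RealInnerProductSpace Matrix
open Literature.MathematicalPhysics.QuantumFieldTheory
open Literature.MathematicalPhysics.QuantumLattice
open Literature.MathematicalPhysics.QuantumFieldTheory.Balaban1983to89.T4CubeChartGnomonic (gnoPoint)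

namespace Summit.QuantumFields.YangMills.Theorems.FemtoTransferGap.TwoLattice.ConstTube

open Summit.QuantumFields.YangMills.Theorems.FemtoTransferGap
open Summit.QuantumFields.YangMills.Theorems.FemtoTransferGap.TwoLattice
open Summit.QuantumFields.YangMills.Theorems.FemtoTransferGap.TwoLattice.Stiff
open Summit.QuantumFields.YangMills.Theorems.FemtoTransferGap.TwoLattice.GnChart
open Summit.QuantumFields.YangMills.Theorems.FemtoTransferGap.TwoLattice.Chart (one_sub_scalarPart_le)

variable {L : ℕ} [NeZero L]

/-! ## §1 The polar-mean chart of a chart point -/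

omit [NeZero L] in
/-- On the chart ball every link of `P(w)` has `1 − ρ²/2 ≤ scalarPart`, and its vector part is `s_e·w_e` with `0 ≤ 1 − s_e ≤ ρ²/2`, `|w_e a| ≤ ρ`. [folklore] -/
theorem latPatternChart_link_data {ρ : ℝ} (hρ0 : 0 ≤ ρ) {w : Edge 3 L → Fin 3 → ℝ} (hw : ∀ e, ∑ a, w e a ^ 2 ≤ ρ ^ 2) (e : Edge 3 L) :
    1 - ρ ^ 2 / 2 ≤ scalarPart (latPatternChart L (fun _ => false) w e) ∧ 0 ≤ 1 - scalarPart (latPatternChart L (fun _ => false) w e) ∧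
      scalarPart (latPatternChart L (fun _ => false) w e) ≤ 1 ∧
      (∀ a, vecPart (latPatternChart L (fun _ => false) w e) a = scalarPart (latPatternChart L (fun _ => false) w e) * w e a) ∧ ∀ a, |w e a| ≤ ρ := by
  rw [latPatternChart_false]
  obtain ⟨_, h0, h1, _⟩ := link_chart_bounds (w e)
  obtain ⟨_, _, hv⟩ := gnoPoint_chart (w e)
  refine ⟨by linarith [hw e], h0, by linarith, hv, fun a => ?_⟩
  have h := (Finset.single_le_sum (f := fun b => w e b ^ 2) (fun b _ => sq_nonneg _) (Finset.mem_univ a)).trans (hw e)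
  exact abs_le_of_sq_le_sq' (by simpa using h) hρ0 |> fun h' => abs_le.2 ⟨h'.1, h'.2⟩

/-- The slow vector parts of a chart point: `|κ_{k,a}| ≤ 2ρ`, `0 ≤ scalarPart p_k`, `0 ≤ 1 − scalarPart p_k ≤ 12ρ²` (`ρ ≤ 1`). [folklore] -/
theorem latPatternChart_polarMean_data {ρ : ℝ} (hρ0 : 0 ≤ ρ) (hρ1 : ρ ≤ 1) {w : Edge 3 L → Fin 3 → ℝ} (hw : ∀ e, ∑ a, w e a ^ 2 ≤ ρ ^ 2) (k : Fin 3) :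
    0 ≤ scalarPart (polarMean L k (latPatternChart L (fun _ => false) w)) ∧ (∀ a, |vecPart (polarMean L k (latPatternChart L (fun _ => false) w)) a| ≤ 2 * ρ) ∧
      0 ≤ 1 - scalarPart (polarMean L k (latPatternChart L (fun _ => false) w)) ∧ 1 - scalarPart (polarMean L k (latPatternChart L (fun _ => false) w)) ≤ 12 * ρ ^ 2 := by
  have hτ0 : 0 ≤ ρ ^ 2 / 2 := by positivity
  have hτ : ρ ^ 2 / 2 ≤ 1 / 2 := by nlinarith
  have hU : ∀ e : Edge 3 L, 1 - ρ ^ 2 / 2 ≤ scalarPart (latPatternChart L (fun _ => false) w e) := fun e => (latPatternChart_link_data hρ0 hw e).1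
  obtain ⟨hs, hv⟩ := polarMean_near L hτ0 hτ hU k
  have hsqrt : Real.sqrt (2 * (ρ ^ 2 / 2)) = ρ := by rw [show 2 * (ρ ^ 2 / 2) = ρ ^ 2 by ring, Real.sqrt_sq hρ0]
  rw [hsqrt] at hv
  have hva : ∀ a, |vecPart (polarMean L k (latPatternChart L (fun _ => false) w)) a| ≤ 2 * ρ := fun a => by
    have := norm_le_pi_norm (vecPart (polarMean L k (latPatternChart L (fun _ => false) w))) a
    rw [Real.norm_eq_abs] at this; exact this.trans hv
  obtain ⟨h0, h1⟩ := one_sub_scalarPart_le _ hs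
  refine ⟨hs, hva, h0, h1.trans ?_⟩
  calc ∑ a, vecPart (polarMean L k (latPatternChart L (fun _ => false) w)) a ^ 2 ≤ ∑ _a : Fin 3, (2 * ρ) ^ 2 := Finset.sum_le_sum fun a _ => by
        rw [← sq_abs]; exact pow_le_pow_left₀ (abs_nonneg _) (hva a) 2
    _ = 12 * ρ ^ 2 := by simp; ring

/-- Components of a cross product are bounded by `2AB`. [folklore] -/
theorem abs_crossProduct_apply_le {a b : Fin 3 → ℝ} {A B : ℝ} (ha : ∀ i, |a i| ≤ A) (hb : ∀ i, |b i| ≤ B) (i : Fin 3) : |(a ⨯₃ b) i| ≤ 2 * A * B := by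
  have hA : 0 ≤ A := (abs_nonneg _).trans (ha 0)
  have hB : 0 ≤ B := (abs_nonneg _).trans (hb 0)
  have hprod : ∀ j k, |a j * b k| ≤ A * B := fun j k => by rw [abs_mul]; exact mul_le_mul (ha j) (hb k) (abs_nonneg _) hA
  rw [cross_apply]
  fin_cases i <;> simp <;>
    [exact (abs_sub _ _).trans (by linarith [hprod 1 2, hprod 2 1]); exact (abs_sub _ _).trans (by linarith [hprod 2 0, hprod 0 2]);
      exact (abs_sub _ _).trans (by linarith [hprod 0 1, hprod 1 0])]

/-! ## §2 ★ The decomposition `chartVec w − relLinkVec (P w) = constant mode + O(ρ²)` -/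

/-- ★ **Decomposition of the relative coordinate of a chart point**: with `κ_{k} = vecPart(polarMean_k (P w))` and the constant mode `κ̄(e,a) = κ_{dir e, a}`,
every component of `chartVec w − relLinkVec (P w) − κ̄` is at most `7ρ²` in absolute value (`0 ≤ ρ ≤ 1/5`). [folklore] -/
theorem relLinkVec_chart_decomposition {ρ : ℝ} (hρ0 : 0 ≤ ρ) (hρ5 : ρ ≤ 1 / 5) {w : Edge 3 L → Fin 3 → ℝ} (hw : ∀ e, ∑ a, w e a ^ 2 ≤ ρ ^ 2) (e : Edge 3 L) (a : Fin 3) :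
    |(chartVec w - relLinkVec L (latPatternChart L (fun _ => false) w) -
        (WithLp.toLp 2 fun ea : Edge 3 L × Fin 3 => vecPart (polarMean L ea.1.2 (latPatternChart L (fun _ => false) w)) ea.2 : LinkSpace L)) (e, a)| ≤ 7 * ρ ^ 2 := by
  set V := latPatternChart L (fun _ => false) w with hV
  set p := polarMean L e.2 V with hp
  obtain ⟨hswlo, hsw0, hsw1, hvw, hwa⟩ := latPatternChart_link_data hρ0 hw e
  obtain ⟨hsp, hκ, hsp0, hsp1⟩ := latPatternChart_polarMean_data hρ0 (by linarith) hw e.2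
  rw [← hV] at hswlo hsw0 hsw1 hvw hsp hκ hsp0 hsp1
  set sw := scalarPart (V e) with hsw
  set sp := scalarPart p with hspdef
  have h1sw : 1 - sw ≤ ρ ^ 2 / 2 := by linarith
  have hρsq : ρ ^ 2 ≤ 1 := by nlinarith
  have hswpos : 0 ≤ sw := by linarith
  -- the component
  have hcomp : (chartVec w - relLinkVec L V - (WithLp.toLp 2 fun ea : Edge 3 L × Fin 3 => vecPart (polarMean L ea.1.2 V) ea.2 : LinkSpace L)) (e, a) =
      w e a - vecPart (V e * p⁻¹) a - vecPart p a := by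
    simp [relLinkVec, chartVec_apply, hp]
  rw [hcomp, vecPart_mul_inv]
  simp only [Pi.add_apply, Pi.neg_apply, Pi.sub_apply, Pi.smul_apply, smul_eq_mul]
  rw [hvw a]
  -- `w − (−sw κ + sp (sw w) − (sw w) × κ) − κ = w(1 − sp sw) − (1 − sw)κ + (sw w) × κ`
  have hcross : |(vecPart (V e) ⨯₃ vecPart p) a| ≤ 2 * ρ * (2 * ρ) := by
    refine abs_crossProduct_apply_le (fun i => ?_) hκ a
    rw [hvw i, abs_mul, abs_of_nonneg hswpos]
    calc sw * |w e i| ≤ 1 * ρ := mul_le_mul hsw1 (hwa i) (abs_nonneg _) zero_le_one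
      _ = ρ := one_mul ρ
  have hterm1 : |w e a * (1 - sp * sw)| ≤ ρ * (25 / 2 * ρ ^ 2) := by
    rw [abs_mul]
    refine mul_le_mul (hwa a) ?_ (abs_nonneg _) hρ0
    have h0 : 0 ≤ 1 - sp * sw := by nlinarith
    rw [abs_of_nonneg h0]; nlinarith
  have hterm2 : |(1 - sw) * vecPart p a| ≤ ρ ^ 2 / 2 * (2 * ρ) := by
    rw [abs_mul, abs_of_nonneg hsw0]; exact mul_le_mul h1sw (hκ a) (abs_nonneg _) (by positivity)
  have hexpr : w e a - (-(sw * vecPart p a) + sp * (sw * w e a) - (vecPart (V e) ⨯₃ vecPart p) a) - vecPart p a =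
      w e a * (1 - sp * sw) - (1 - sw) * vecPart p a + (vecPart (V e) ⨯₃ vecPart p) a := by ring
  rw [hexpr]
  calc _ ≤ |w e a * (1 - sp * sw) - (1 - sw) * vecPart p a| + |(vecPart (V e) ⨯₃ vecPart p) a| := abs_add_le _ _
    _ ≤ (|w e a * (1 - sp * sw)| + |(1 - sw) * vecPart p a|) + |(vecPart (V e) ⨯₃ vecPart p) a| := by gcongr; exact abs_sub _ _
    _ ≤ ρ * (25 / 2 * ρ ^ 2) + ρ ^ 2 / 2 * (2 * ρ) + 2 * ρ * (2 * ρ) := by gcongr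
    _ ≤ 7 * ρ ^ 2 := by nlinarith

/-- The constant mode `κ̄` lies in the kernel of `t·H`. [folklore] -/
theorem smul_stiffHessian_constMode_eq_zero (t : ℝ) (c : Fin 3 → Fin 3 → ℝ) :
    (t • stiffHessian L) (WithLp.toLp 2 fun ea : Edge 3 L × Fin 3 => c ea.1.2 ea.2) = 0 := by
  rw [LinearMap.smul_apply, stiffHessian_eq_zero_of_latCurl L (latCurl_constMode L c), smul_zero]

/-! ## §3 ★★ The stiff exponent at the relative coordinate vs at the chart coordinate -/

/-- ★★ **`|q_{t,b}(relLinkVec (P w)) − q_{t,b}(chartVec w)| ≤ 72·|E|·(96t+b)·ρ³`** on the chart ball `Σ_a w_e a² ≤ ρ²`, `0 ≤ ρ ≤ 1/5` (`t, b ≥ 0`). [folklore] -/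
theorem abs_stiffGaussExp_relLinkVec_sub_chart_le {t : ℝ} (ht : 0 ≤ t) {b : ℝ} (hb : 0 ≤ b) {ρ : ℝ} (hρ0 : 0 ≤ ρ) (hρ5 : ρ ≤ 1 / 5)
    {w : Edge 3 L → Fin 3 → ℝ} (hw : ∀ e, ∑ a, w e a ^ 2 ≤ ρ ^ 2) :
    |stiffGaussExp L t b (relLinkVec L (latPatternChart L (fun _ => false) w)) - stiffGaussExp L t b (chartVec w)| ≤ 72 * Fintype.card (Edge 3 L) * (96 * t + b) * ρ ^ 3 := by
  set V := latPatternChart L (fun _ => false) w with hV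
  set x : LinkSpace L := chartVec w with hx
  set κ : LinkSpace L := WithLp.toLp 2 fun ea : Edge 3 L × Fin 3 => vecPart (polarMean L ea.1.2 V) ea.2 with hκ
  set Rem : LinkSpace L := x - relLinkVec L V - κ with hRem
  set E : ℝ := (Fintype.card (Edge 3 L) : ℝ) with hE
  have hE1 : 1 ≤ E := by rw [hE]; exact_mod_cast Fintype.card_pos
  -- `relLinkVec V = (x − Rem) − κ`, and `κ` is invisible to `q`
  have hrel : relLinkVec L V = (x - Rem) + (-κ) := by rw [hRem]; abel
  have hker : (t • stiffHessian L) (-κ) = 0 := by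
    have h := smul_stiffHessian_constMode_eq_zero (L := L) t (fun k a => vecPart (polarMean L k V) a)
    rw [map_neg, neg_eq_zero, hκ]; exact h
  have hq1 : stiffGaussExp L t b (relLinkVec L V) = stiffGaussExp L t b (x - Rem) := by rw [hrel, stiffGaussExp_add_of_ker b hker]
  -- norms
  have hRem_comp : ∀ ea : Edge 3 L × Fin 3, |Rem ea| ≤ 7 * ρ ^ 2 := fun ea => by
    obtain ⟨e, a⟩ := ea
    exact relLinkVec_chart_decomposition hρ0 hρ5 hw e a
  have hRem_sq : ‖Rem‖ ^ 2 ≤ 3 * E * (7 * ρ ^ 2) ^ 2 := by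
    rw [EuclideanSpace.norm_sq_eq]
    calc ∑ ea, ‖Rem ea‖ ^ 2 ≤ ∑ _ea : Edge 3 L × Fin 3, (7 * ρ ^ 2) ^ 2 := Finset.sum_le_sum fun ea _ => by
          rw [Real.norm_eq_abs]; exact pow_le_pow_left₀ (abs_nonneg _) (hRem_comp ea) 2
      _ = 3 * E * (7 * ρ ^ 2) ^ 2 := by rw [Finset.sum_const, Finset.card_univ, Fintype.card_prod, Fintype.card_fin, nsmul_eq_mul]; push_cast; rw [hE]; ring
  have hx_sq : ‖x‖ ^ 2 ≤ 3 * E * ρ ^ 2 := by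
    rw [hx, norm_chartVec_sq]
    calc ∑ e, ∑ a, w e a ^ 2 ≤ ∑ _e : Edge 3 L, ρ ^ 2 := Finset.sum_le_sum fun e _ => hw e
      _ = E * ρ ^ 2 := by rw [Finset.sum_const, Finset.card_univ, nsmul_eq_mul]
      _ ≤ 3 * E * ρ ^ 2 := by nlinarith [sq_nonneg ρ]
  have hxR : ‖x‖ * ‖Rem‖ ≤ 21 * E * ρ ^ 3 := by
    have h1 : (‖x‖ * ‖Rem‖) ^ 2 ≤ (21 * E * ρ ^ 3) ^ 2 := by
      rw [mul_pow]
      calc ‖x‖ ^ 2 * ‖Rem‖ ^ 2 ≤ (3 * E * ρ ^ 2) * (3 * E * (7 * ρ ^ 2) ^ 2) := mul_le_mul hx_sq hRem_sq (by positivity) (by positivity)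
        _ = (21 * E * ρ ^ 3) ^ 2 := by ring
    exact (pow_le_pow_iff_left₀ (by positivity) (by positivity) two_ne_zero).1 h1
  have hRR : ‖Rem‖ ^ 2 ≤ 30 * E * ρ ^ 3 := by
    calc ‖Rem‖ ^ 2 ≤ 3 * E * (7 * ρ ^ 2) ^ 2 := hRem_sq
      _ = 147 * E * ρ ^ 3 * ρ := by ring
      _ ≤ 147 * E * ρ ^ 3 * (1 / 5) := by gcongr
      _ ≤ 30 * E * ρ ^ 3 := by nlinarith [pow_nonneg hρ0 3]
  -- Lipschitz
  have hlip := abs_stiffGaussExp_sub_le ht hb (x - Rem) x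
  have hdiff : ‖x - Rem - x‖ = ‖Rem‖ := by rw [sub_sub_cancel_left, norm_neg]
  have hsum : ‖x - Rem + x‖ ≤ 2 * ‖x‖ + ‖Rem‖ := by
    calc ‖x - Rem + x‖ = ‖(x + x) - Rem‖ := by abel_nf
      _ ≤ ‖x + x‖ + ‖Rem‖ := norm_sub_le _ _
      _ ≤ (‖x‖ + ‖x‖) + ‖Rem‖ := by gcongr; exact norm_add_le _ _
      _ = 2 * ‖x‖ + ‖Rem‖ := by ring
  rw [hq1]
  calc |stiffGaussExp L t b (x - Rem) - stiffGaussExp L t b x| ≤ (96 * t + b) * ‖x - Rem - x‖ * ‖x - Rem + x‖ := hlip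
    _ ≤ (96 * t + b) * ‖Rem‖ * (2 * ‖x‖ + ‖Rem‖) := by rw [hdiff]; gcongr
    _ = (96 * t + b) * (2 * (‖x‖ * ‖Rem‖) + ‖Rem‖ ^ 2) := by ring
    _ ≤ (96 * t + b) * (2 * (21 * E * ρ ^ 3) + 30 * E * ρ ^ 3) := by gcongr
    _ = 72 * E * (96 * t + b) * ρ ^ 3 := by ring

end Summit.QuantumFields.YangMills.Theorems.FemtoTransferGap.TwoLattice.ConstTube

end
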